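import Summits.Langlands.Langlands.Theses.FrobeniusMomentIrreducibility
import Summits.Langlands.Langlands.Theorems.PhantomRMYoshidaPhantomRMJunctionOfR
import HarnessLib

/-!
# Birth skeleton (BC3) for crux stmt-Langlands-19274 `FrobeniusMomentIrreducibility.RestOfReciprocity` — line `birth`, rev 1

Registrar: planner-skel-stmt-Langlands-19274-0 (skeleton-register one-shot, route re-audit bin HONEST),
2026-08-17.  Route `route-Langlands-FrobeniusMomentIrreducibility` (rev 1; deciding theorem
`closes (hA : MeanSquareTraceAtLeastOne) (hB : TraceCorrelationNonneg) (hJS : PairLPoleJS)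
(hG : IrreducibleOfMoments) (hR : RestOfReciprocity) : Langlands := hR (hG hA hB hJS)`).
NB: the crux directory `Cruxes/RestOfReciprocity/` is SHARED with the homonymous frame item
stmt-Langlands-18056 of route `ExteriorSquareAscent`, whose live registered line is `Lines/birth.lean`
(rev 3, lead prover-line-stmt-Langlands-18056-c1-0); THIS file concerns stmt-Langlands-19274 only and is
therefore published as `Lines/birth_FrobeniusMomentIrreducibility.lean`.

  `RestOfReciprocity := IrreduciblePureCompatible → _root_.Langlands`

is the route's declared RESIDUAL (rank 4, "not attacked by this route"): the rest of `GL_n` reciprocity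
outside the sector X = `IrreduciblePureCompatible` (irreducibility of every `ℓ`-adic `ρ` that is
Satake–Frobenius compatible a.e. with a cuspidal `π` of `GL_n(𝔸_F)`, de Rham above `ℓ` and `ι`-pure of an
integer weight) — direction (B), the existence / geometricity / local–global-compatibility-at-EVERY-place /
uniqueness half of direction (A), the non-vacuity conjunct `Nonempty (ReciprocityData F)` and the `∀ 𝓡`
clause.  OPEN PROBLEM by construction; `Langlands → RestOfReciprocity` is `fun h _ => h`.

## The honest decomposition: by-name / by-text leaves R ∧ JS (2.2) ∧ JS (2.3); X inert

After the 2026-08-16 re-type of the summit (`∀ F, Nonempty (ReciprocityData F) ∧ ∀ 𝓡 n hcpt, (A) ∧ (B)`)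
the open content of every "X → Langlands" junction of this summit lives in EXISTING items, and the tree
certifies the seam (landed, sorry-free):
`PhantomRMYoshidaJunctionOfR.langlands_of_reciprocityUpToIrreducibilityR_text_of_JS : JS (2.2) → JS (2.3) → R → Langlands`
(`Theorems/PhantomRMYoshidaPhantomRMJunctionOfR.lean`: for each `𝓡`, clause (B) is R's; clause (A)'s
avatar is R's, irreducible by the landed isobaric bootstrap
`IrreducibleOffSector.isIrreducible_of_reciprocityUpToIrreducibility` (p103935), unique up to conjugacy by
Flath + Chebotarev–Brauer–Nesbitt + `FramedRep.exists_eq_conj_of_equiv`).  Exactly as certified for the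
sibling junctions stmt-Langlands-18056 (`ExteriorSquareAscent.RestOfReciprocity`, `Lines/birth.lean` rev 3),
stmt-Langlands-18277 (`TameTypeSwitch.SectorComplement`), stmt-Langlands-18275
(`EisensteinGelfandKirillov.SectorComplement`) and stmt-Langlands-13643 (`PhantomRMYoshida.PhantomRMJunction`),
the stubs are therefore:

* `stub_reciprocityUpToIrreducibilityR` — VERBATIM the text of item **stmt-Langlands-17925**
  `IrreducibilityBySelfDuality.ReciprocityUpToIrreducibilityR` (reciprocity up to irreducibility for EVERY
  pinned reciprocity datum, with the non-vacuity conjunct; OPEN PROBLEM — the summit minus irreducibility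
  and uniqueness-up-to-conjugacy in clause (A); own crux chain `Cruxes/ReciprocityUpToIrreducibility`;
  written out because the decl lives in another route's Theses module).
* `stub_pairLBoundaryJS` — `AnalyticDescent.PairLBoundaryJS` = item **stmt-Langlands-13622** BY NAME
  (shared decl of several routes; Arthur–Clozel Ch. 3 §2 (2.2) = Jacquet–Shalika 1981 + Shahidi:
  non-vanishing of the partial Rankin–Selberg product on Re s = 1 off the X-condition; a theorem in print;
  crux chain `Cruxes/PairLBoundaryJS`).  NOT an item of this route (the route's own Rankin dévissage
  `IrreducibleOfMoments` needs only the pole (2.3)); it enters here because the residual's clause (A)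
  needs irreducibility of EVERY corresponding avatar, for L-algebraic `π` that need not satisfy X's purity
  clause, and uniqueness up to conjugacy.
* `stub_pairLPoleJS` — THIS ROUTE'S OWN support item `FrobeniusMomentIrreducibility.PairLPoleJS` =
  **stmt-Langlands-19093** BY NAME (shared decl; `↔ AnalyticDescent.PairLPoleJS` by `Iff.rfl`,
  `pairLPoleJS_iff` below; Arthur–Clozel (2.3) = Jacquet–Shalika II Prop. 3.6: the simple pole in the
  X-condition; a theorem in print).

`RestOfReciprocity_of` (kernel-checked, no `sorry`; hypotheses BY STUB NAME through
`_Goal.stub_* := type_of% @stub_*`, the device of `Lines/birth.lean` rev 3 that `ledger skeleton check`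
admits): discard X and apply the seam.  X is visibly unused (`intro _hX`): that is the FINDING of this
registration, not an oversight — given R (which any proof of the residual needs: `Langlands → R`,
`reciprocityUpToIrreducibilityR_text_of_langlands`) and JS (2.2)–(2.3) (theorems in print), irreducibility
of `ρ_π` in EVERY rank is free by the isobaric bootstrap, so the sector X = `IrreduciblePureCompatible`
(and with it the route's attacked cruxes A `MeanSquareTraceAtLeastOne`, B `TraceCorrelationNonneg`)
cannot shrink the residual; conversely X cannot replace JS (2.2) here without a purity (Ramanujan-type)
input for `ρ_π` that the summit does not assert.  `¬C ↔ X ∧ ¬Langlands` (`not_restOfReciprocity_iff`).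

Outcome this skeleton supports: `blocked-on: stmt-Langlands-17925` (then 13622 / 19093).  No stub is
delegable to a stub-worker: each is an open item with its own seats.  When all three close,
`RestOfReciprocity_of` lands the crux in three lines.

Previous registration (ledger, 2026-08-17T18:38Z, planner-type-e9fb7af640-0, never written to the tree —
`crux write` refused for a non-seat): two ad-hoc stubs `stub_galoisToAutomorphic : GaloisToAutomorphicAll`,
`stub_automorphicToGalois_of_irreducible : AutomorphicToGaloisOfIrreducible` ((B) for all data; X → N ∧ (A)).
Superseded here by the by-name leaves: the second ad-hoc stub is itself "X → (summit minus (B))", whose only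
known decomposition is again R's clause (A') + the bootstrap, i.e. X inert.

Disproof used: `Cruxes/RestOfReciprocity/Disproof.lean` (cdisprove for stmt-Langlands-18056, 2026-08-17):
NO KILL by design (`¬C ↔ X ∧ ¬Langlands`); nothing in it quantifies over this route's X; no
`Theorems/RestOfReciprocity/Negative/`.  Negatives index (`ledger negatives --problem Langlands`): none of
the shape of a stub.

References: K. Buzzard, T. Gee, LMS LNS 414 (2014), Conj. 3.2.1–3.2.2 [BuzzardGeeLMS2014]; J.-M. Fontaine,
B. Mazur (1995), Conj. 1 [FontaineMazurGeometric1995]; J. Arthur, L. Clozel, Ann. Math. Stud. 120, Ch. 3 §2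
(2.2)–(2.3) [ArthurClozelAMS120]; H. Jacquet, J. Shalika, Amer. J. Math. 103 (1981) I §5, II Prop. 3.6 /
Thm. 4.4 [JacquetShalikaAJM1981II]; M. Harris, R. Taylor, Ann. Math. Stud. 151 (2001), Thm. A
[HarrisTaylorAMS2001]; F. Calegari, T. Gee, Ann. Inst. Fourier 63 (2013) §1.1 [CalegariGee2013];
K. Ribet, LNM 601 (1977), Thm. 2.3 (the route's lever, not used by the residual).
-/

noncomputable section

set_option linter.dupNamespace false -- project-wide option; `Summit.Langlands.Langlands` is the mandated namespace

open scoped NumberField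
open Filter IsDedekindDomain
open Literature.NumberTheory.Automorphic Literature.NumberTheory.GaloisRepresentations
open Summit.Langlands
open Summit.Langlands.Langlands.Theses.FrobeniusMomentIrreducibility (RestOfReciprocity IrreduciblePureCompatible PairLPoleJS)

namespace Summit.Langlands.Langlands.Cruxes.RestOfReciprocity.FrobeniusMomentIrreducibilityBirth

/-! ## 0. The crux, by name -/

/-- The crux IS `X → Langlands`, definitionally (X = the route target `IrreduciblePureCompatible`). [folklore] -/
theorem restOfReciprocity_iff :
    RestOfReciprocity ↔ (IrreduciblePureCompatible → _root_.Langlands) :=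
  Iff.rfl

/-- Logical position of the residual: refuting it is EXACTLY proving the sector X together with refuting the
formal summit. [folklore] -/
theorem not_restOfReciprocity_iff :
    ¬ RestOfReciprocity ↔ (IrreduciblePureCompatible ∧ ¬ _root_.Langlands) := by
  rw [restOfReciprocity_iff, Classical.not_imp]

/-- For the record (converse direction, informational `S → C`): the summit gives the crux outright — an
`example`, so that no declaration of this file concludes the crux except the composition. -/
example (h : _root_.Langlands) : RestOfReciprocity :=
  fun _ => h

/-! ## 1. The three stubs (the ONLY sorries of this file) — each an existing OPEN item -/

/-- **stub R — reciprocity up to irreducibility for every pinned reciprocity datum** = the text of item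
stmt-Langlands-17925 `IrreducibilityBySelfDuality.ReciprocityUpToIrreducibilityR`, VERBATIM: for every number
field `F`, (i) reciprocity data exist (`Nonempty (ReciprocityData F)`: a local Langlands datum at every
completion pinned to THE canonical Artin maps — Harris–Taylor 2001 Thm. A / Henniart 2000 + local class
field theory), and (ii) for EVERY datum `Rec`, every `n ≥ 1`, `hcpt`: (A') every L-algebraic cuspidal `π` of
`GL_n(𝔸_F)` has, for all `ℓ, ι`, SOME geometric `ρ` corresponding to it at every finite place (no
irreducibility, no uniqueness), and (B) every irreducible geometric `ρ` corresponds to some L-algebraic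
cuspidal `π`.  OPEN PROBLEM (the summit minus irreducibility/uniqueness in (A)).  Size: open-problem; never
delegated — it is item stmt-Langlands-17925 with its own crux chain.
[cite: BuzzardGeeLMS2014, Conj. 3.2.1 and Conj. 3.2.2] [cite: FontaineMazurGeometric1995, Conj. 1]
[cite: HarrisTaylorAMS2001, Thm. A] -/
theorem stub_reciprocityUpToIrreducibilityR : ∀ (F : Type) [Field F] [NumberField F], Nonempty (ReciprocityData F) ∧ ∀ (Rec : ReciprocityData F) (n : ℕ), 0 < n → ∀ hcpt : Literature.NumberTheory.Automorphic.isCompact_glFiniteIntegralLevel n F, (∀ π : Literature.NumberTheory.Automorphic.CuspidalAutomorphicRepData n F hcpt, π.1.IsLAlgebraic → ∀ (ℓ : ℕ) [Fact ℓ.Prime] (ι : PadicAlgCl ℓ ≃+* ℂ), ∃ ρ : Literature.NumberTheory.GaloisRepresentations.FramedGaloisRep F (PadicAlgCl ℓ) n, IsGeometricFramed Rec ρ ∧ Corresponds Rec ι π.1 ρ) ∧ GaloisToAutomorphic n Rec hcpt := by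
  sorry

/-- **stub JS (2.2) — Jacquet–Shalika / Arthur–Clozel Ch. 3 §2 (2.2) for cuspidal Borel–Jacquet data**,
BY NAME: `AnalyticDescent.PairLBoundaryJS` = item stmt-Langlands-13622 (shared decl): off the X-condition,
with unitary central characters a.e., the partial Rankin–Selberg product `L^S(s, α × β)` has a finite
NON-ZERO limit at every `s₀` on `Re s = 1` from `Re s > 1`.  A theorem in print (JS 1981 I §5 + Shahidi
1981); size XL (archimedean / `L²` leaves; crux chain `Cruxes/PairLBoundaryJS`).
[cite: JacquetShalikaAJM1981II, Thm. 4.4] [cite: ArthurClozelAMS120, Ch. 3 §2 (2.2)] -/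
theorem stub_pairLBoundaryJS : Summit.Langlands.Langlands.Theses.AnalyticDescent.PairLBoundaryJS := by
  sorry

/-- **stub JS (2.3) — Jacquet–Shalika II Prop. 3.6 / Arthur–Clozel Ch. 3 §2 (2.3)**, BY NAME this route's
own support item `FrobeniusMomentIrreducibility.PairLPoleJS` = item stmt-Langlands-19093 (shared decl): in the
X-condition (`q_w^{1-s₀}·α_w = β_w⁻¹` a.e.) the partial Rankin–Selberg product has a SIMPLE POLE at `s₀`
(`(s - s₀)·L^S(s, α × β)` tends to a non-zero limit).  A theorem in print; size XL (in tree reduced to the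
single Literature leaf `JacquetShalika1990_archRankinSelbergLIntegral_lt_top` for `n ≥ 3`, proved for `n ≤ 2`).
[cite: JacquetShalikaAJM1981II, Prop. 3.6] [cite: ArthurClozelAMS120, Ch. 3 §2 (2.3)] -/
theorem stub_pairLPoleJS : PairLPoleJS := by
  sorry

/-! ### Bridge: this route's `PairLPoleJS` IS `AnalyticDescent.PairLPoleJS` (one item, stmt-Langlands-19093) -/

/-- The route item `FrobeniusMomentIrreducibility.PairLPoleJS` and `AnalyticDescent.PairLPoleJS` are the same
text (item stmt-Langlands-19093), definitionally. [folklore] -/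
theorem pairLPoleJS_iff :
    PairLPoleJS ↔ Summit.Langlands.Langlands.Theses.AnalyticDescent.PairLPoleJS :=
  Iff.rfl

/-! ## 2. The stub statements as named propositions (hypotheses of the composition, admissible by stub name)

Each `_Goal.stub_x` is `type_of% @stub_x`: literally the stub's statement, no text duplicated, no `sorry`
inherited (same device as `Cruxes/RestOfReciprocity/Lines/birth.lean` rev 3). -/

namespace _Goal

/-- The statement of `stub_reciprocityUpToIrreducibilityR` (literally its type). [folklore] -/
def stub_reciprocityUpToIrreducibilityR : Prop :=
  type_of% @Summit.Langlands.Langlands.Cruxes.RestOfReciprocity.FrobeniusMomentIrreducibilityBirth.stub_reciprocityUpToIrreducibilityR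

/-- The statement of `stub_pairLBoundaryJS` (literally its type). [folklore] -/
def stub_pairLBoundaryJS : Prop :=
  type_of% @Summit.Langlands.Langlands.Cruxes.RestOfReciprocity.FrobeniusMomentIrreducibilityBirth.stub_pairLBoundaryJS

/-- The statement of `stub_pairLPoleJS` (literally its type). [folklore] -/
def stub_pairLPoleJS : Prop :=
  type_of% @Summit.Langlands.Langlands.Cruxes.RestOfReciprocity.FrobeniusMomentIrreducibilityBirth.stub_pairLPoleJS

end _Goal

/-! ## 3. The composition (kernel-checked, no sorry): R → JS (2.2) → JS (2.3) → the crux BY NAME -/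

/-- **`FrobeniusMomentIrreducibility.RestOfReciprocity` from its three leaves.**  Discard the sector
hypothesis `IrreduciblePureCompatible` (inert: irreducibility in clause (A) is free given (A') + (B) + JS
by the isobaric bootstrap, for every L-algebraic `π`, pure or not) and conclude `Langlands` from R and
JS (2.2)–(2.3) by the landed seam
`PhantomRMYoshidaJunctionOfR.langlands_of_reciprocityUpToIrreducibilityR_text_of_JS` (clause (B) is R's;
the avatar of clause (A) is R's, irreducible by the bootstrap, unique up to conjugacy by Flath +
Chebotarev–Brauer–Nesbitt).  Hypotheses = the three stub statements BY STUB NAME (`_Goal.stub_*`), in the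
order R, (2.2), (2.3); conclusion = the route decl
`Summit.Langlands.Langlands.Theses.FrobeniusMomentIrreducibility.RestOfReciprocity` by name.
[cite: BuzzardGeeLMS2014, Conj. 3.2.1 and Conj. 3.2.2] [cite: ArthurClozelAMS120, Ch. 3 §2 (2.2)–(2.3)] -/
theorem RestOfReciprocity_of (h1 : _Goal.stub_reciprocityUpToIrreducibilityR) (h2 : _Goal.stub_pairLBoundaryJS)
    (h3 : _Goal.stub_pairLPoleJS) :
    Summit.Langlands.Langlands.Theses.FrobeniusMomentIrreducibility.RestOfReciprocity := by
  dsimp only [_Goal.stub_reciprocityUpToIrreducibilityR, _Goal.stub_pairLBoundaryJS, _Goal.stub_pairLPoleJS]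
    at h1 h2 h3
  rw [restOfReciprocity_iff]
  intro _hX
  exact Summit.Langlands.Langlands.Theorems.PhantomRMYoshidaJunctionOfR.langlands_of_reciprocityUpToIrreducibilityR_text_of_JS
    h2 (pairLPoleJS_iff.mp h3) h1

/-- By-name sanity check (an `example`, not a declaration, so that exactly one theorem of this file concludes the
crux): the three stubs feed the composition as they stand. -/
example : Summit.Langlands.Langlands.Theses.FrobeniusMomentIrreducibility.RestOfReciprocity :=
  RestOfReciprocity_of stub_reciprocityUpToIrreducibilityR stub_pairLBoundaryJS stub_pairLPoleJS

end Summit.Langlands.Langlands.Cruxes.RestOfReciprocity.FrobeniusMomentIrreducibilityBirth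

end
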